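import Literature.MathematicalPhysics.QuantumFieldTheory.GaussianToolkit

/-!
# The flat Gaussian form bound `⟨Φ, e^{-B|x-y|²} Φ⟩ ≥ (π/B)^{n/2} (‖Φ‖² − ‖∇Φ‖²/(4B))`
# (support module for the registered stub `stub_absLower` of crux `OneSiteLevels`, route `LuscherReduction`,
# item stmt-QuantumFields-20007; fleet seat prover ym-luscher-20007-p2)

The kinetic factor of the one-site transfer kernel is, in the gnomonic chart, a flat Gaussian `e^{-B|v-v'|²}` on `ℝ⁹` up to
controlled errors; the quasimode half of the crux needs a LOWER bound on the Gaussian quadratic form of a trial function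
exact to first order in the variance `1/(2B)`: for `Φ ∈ C¹_c(ℝⁿ)` (`EuclideanSpace ℝ ι`),
`∫∫ Φ(x) e^{-B‖x-y‖²} Φ(y) dx dy ≥ √(π/B)^n · (∫ Φ² − (4B)⁻¹ ∫ ‖∇Φ‖²)` (`gaussForm_ge`) — the real-space shadow of
Jensen's inequality for the heat semigroup, proved WITHOUT semigroups or Fourier analysis from: the autocorrelation identity
`∫ Φ(x)Φ(x+s) dx = ‖Φ‖² − ½ ∫ (Φ(x+s) − Φ(x))² dx`; the segment bound `∫ (Φ(x+s) − Φ(x))² dx ≤ ∫ (DΦ(x)·s)² dx` (FTC along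
`t ↦ x + ts`, Jensen on `[0,1]`, Tonelli, translation invariance); and the directional second moment
`∫ e^{-B‖s‖²} ⟨g,s⟩² ds = ‖g‖² √(π/B)^n/(2B)` (Mathlib's `variance_dual_stdGaussian` + the tree's
`GaussianToolkit.stdGaussian_eq_withDensity` + scaling).  Flat real analysis only ([folklore]); NOT the stub, NOT THE CLAY GAP.
Sorry-free, no named fact.
-/
set_option autoImplicit false

noncomputable section

open MeasureTheory Filter Topology Real ProbabilityTheory
open scoped RealInnerProductSpace ENNReal
open Literature.MathematicalPhysics.QuantumFieldTheory

namespace Summit.QuantumFields.YangMills.Theorems.FemtoTransferGap.GaussForm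

variable {ι : Type*} [Fintype ι]

/-! ### §1. Gaussian integrals: mass and directional second moment -/

/-- `∫ e^{-B‖s‖²} ds = √(π/B)^n` on `ℝⁿ`. [folklore] -/
theorem integral_exp_neg_mul_sq_norm {B : ℝ} (hB : 0 < B) :
    ∫ s : (EuclideanSpace ℝ ι), Real.exp (-B * ‖s‖ ^ 2) = Real.sqrt (π / B) ^ Fintype.card ι := by
  rw [GaussianFourier.integral_rexp_neg_mul_sq_norm hB, finrank_euclideanSpace,
    Real.sqrt_eq_rpow, ← Real.rpow_natCast, ← Real.rpow_mul (by positivity)]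
  congr 1
  ring

/-- `∫ ⟨g,t⟩² dγ(t) = ‖g‖²` for the standard Gaussian `γ`. [folklore] -/
theorem integral_inner_sq_stdGaussian (g : (EuclideanSpace ℝ ι)) : ∫ t, ⟪g, t⟫ ^ 2 ∂(stdGaussian (EuclideanSpace ℝ ι)) = ‖g‖ ^ 2 := by
  have h := variance_dual_stdGaussian (E := (EuclideanSpace ℝ ι)) (innerSL ℝ g)
  rw [variance_of_integral_eq_zero (innerSL ℝ g).continuous.aemeasurable (integral_strongDual_stdGaussian _),
    innerSL_apply_norm] at h
  simpa only [innerSL_apply_apply] using h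

/-- `∫ ⟨g,t⟩² e^{-‖t‖²/2} dt = √(2π)^n ‖g‖²`. [folklore] -/
theorem integral_inner_sq_mul_exp_neg_half (g : (EuclideanSpace ℝ ι)) :
    ∫ t : (EuclideanSpace ℝ ι), ⟪g, t⟫ ^ 2 * Real.exp (-‖t‖ ^ 2 / 2) = Real.sqrt (2 * π) ^ Fintype.card ι * ‖g‖ ^ 2 := by
  have h := integral_inner_sq_stdGaussian g
  rw [GaussianToolkit.stdGaussian_eq_withDensity, integral_withDensity_eq_integral_toReal_smul
    GaussianToolkit.measurable_stdGaussianDensity (ae_of_all _ fun y => by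
      unfold GaussianToolkit.stdGaussianDensity; exact ENNReal.ofReal_lt_top)] at h
  have hc : 0 < Real.sqrt (2 * π) ^ Fintype.card ι := by positivity
  have e : ∀ t : (EuclideanSpace ℝ ι), (GaussianToolkit.stdGaussianDensity ι t).toReal • ⟪g, t⟫ ^ 2 =
      (Real.sqrt (2 * π) ^ Fintype.card ι)⁻¹ * (⟪g, t⟫ ^ 2 * Real.exp (-‖t‖ ^ 2 / 2)) := by
    intro t
    rw [GaussianToolkit.stdGaussianDensity, ENNReal.toReal_ofReal (by positivity), smul_eq_mul, inv_pow]
    ring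
  simp_rw [e] at h
  rw [integral_const_mul] at h
  have h2 := congrArg (fun r => Real.sqrt (2 * π) ^ Fintype.card ι * r) h
  rw [← mul_assoc, mul_inv_cancel₀ hc.ne', one_mul] at h2
  exact h2

/-- **Directional second moment**: `∫ ⟨g,s⟩² e^{-B‖s‖²} ds = ‖g‖² √(π/B)^n / (2B)`. [folklore] -/
theorem integral_inner_sq_mul_exp_neg_mul_sq_norm {B : ℝ} (hB : 0 < B) (g : (EuclideanSpace ℝ ι)) :
    ∫ s : (EuclideanSpace ℝ ι), ⟪g, s⟫ ^ 2 * Real.exp (-B * ‖s‖ ^ 2) = ‖g‖ ^ 2 * Real.sqrt (π / B) ^ Fintype.card ι / (2 * B) := by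
  set R : ℝ := Real.sqrt (2 * B) with hR
  have hR0 : 0 < R := Real.sqrt_pos.2 (by positivity)
  have hR2 : R ^ 2 = 2 * B := Real.sq_sqrt (by positivity)
  -- `f(R•s) = 2B ⟨g,s⟩² e^{-B‖s‖²}`
  have hscale : ∀ s : (EuclideanSpace ℝ ι), ⟪g, R • s⟫ ^ 2 * Real.exp (-‖R • s‖ ^ 2 / 2) = (2 * B) * (⟪g, s⟫ ^ 2 * Real.exp (-B * ‖s‖ ^ 2)) := by
    intro s
    rw [real_inner_smul_right, norm_smul, Real.norm_of_nonneg hR0.le, mul_pow, mul_pow, hR2]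
    have : -(2 * B * ‖s‖ ^ 2) / 2 = -B * ‖s‖ ^ 2 := by ring
    rw [this]
    ring
  have h := Measure.integral_comp_smul (μ := (volume : Measure (EuclideanSpace ℝ ι)))
    (fun t : (EuclideanSpace ℝ ι) => ⟪g, t⟫ ^ 2 * Real.exp (-‖t‖ ^ 2 / 2)) R
  simp only [hscale, integral_inner_sq_mul_exp_neg_half, finrank_euclideanSpace, smul_eq_mul] at h
  rw [integral_const_mul] at h
  -- solve for the integral
  rw [abs_of_pos (show 0 < (R ^ Fintype.card ι)⁻¹ by positivity)] at h
  have hsq : Real.sqrt (2 * π) = R * Real.sqrt (π / B) := by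
    rw [hR, ← Real.sqrt_mul (by positivity)]
    congr 1
    field_simp
  rw [hsq, mul_pow] at h
  have hRpow : (R ^ Fintype.card ι) ≠ 0 := by positivity
  field_simp at h
  field_simp
  linarith [h]

/-! ### §2. The autocorrelation identity and the segment bound -/

variable {Φ : (EuclideanSpace ℝ ι) → ℝ}

omit [Fintype ι] in
/-- The square of a compactly supported function is compactly supported. [folklore] -/
theorem hasCompactSupport_sq {X : Type*} [TopologicalSpace X] {f : X → ℝ} (hf : HasCompactSupport f) :
    HasCompactSupport fun x => f x ^ 2 :=
  hf.comp_left (g := fun r : ℝ => r ^ 2) (by norm_num)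

omit [Fintype ι] in
/-- A continuous compactly supported function is bounded. [folklore] -/
theorem exists_bound_of_hasCompactSupport (hc : Continuous Φ) (hs : HasCompactSupport Φ) :
    ∃ C : ℝ, 0 ≤ C ∧ ∀ x, |Φ x| ≤ C := by
  obtain ⟨C, hC⟩ := hs.exists_bound_of_continuous hc
  exact ⟨max C 0, le_max_right _ _, fun x => (hC x).trans (le_max_left _ _)⟩

/-- **Autocorrelation identity**: `∫ Φ(x)Φ(x+s) dx = ∫ Φ² − ½ ∫ (Φ(x+s) − Φ(x))² dx`. [folklore] -/
theorem integral_mul_shift_eq (hc : Continuous Φ) (hs : HasCompactSupport Φ) (s : (EuclideanSpace ℝ ι)) :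
    ∫ x, Φ x * Φ (x + s) = (∫ x, Φ x ^ 2) - (1 / 2 : ℝ) * ∫ x, (Φ (x + s) - Φ x) ^ 2 := by
  have hΦs : Continuous fun x => Φ (x + s) := hc.comp (continuous_id.add continuous_const)
  have hΦs_supp : HasCompactSupport fun x => Φ (x + s) := hs.comp_homeomorph (Homeomorph.addRight s)
  have I1 : Integrable (fun x => Φ x ^ 2) := (hc.pow 2).integrable_of_hasCompactSupport (hasCompactSupport_sq hs)
  have I2 : Integrable (fun x => Φ (x + s) ^ 2) :=
    (hΦs.pow 2).integrable_of_hasCompactSupport (hasCompactSupport_sq hΦs_supp)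
  have I3 : Integrable (fun x => Φ x * Φ (x + s)) :=
    (hc.mul hΦs).integrable_of_hasCompactSupport (hs.mul_right)
  have hshift : ∫ x, Φ (x + s) ^ 2 = ∫ x, Φ x ^ 2 := integral_add_right_eq_self (fun x => Φ x ^ 2) s
  have e : ∫ x, (Φ (x + s) - Φ x) ^ 2 = (∫ x, Φ (x + s) ^ 2) - 2 * (∫ x, Φ x * Φ (x + s)) + ∫ x, Φ x ^ 2 := by
    have : ∀ x, (Φ (x + s) - Φ x) ^ 2 = (Φ (x + s) ^ 2 - 2 * (Φ x * Φ (x + s))) + Φ x ^ 2 := fun x => by ring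
    simp_rw [this]
    rw [integral_add (f := fun x => Φ (x + s) ^ 2 - 2 * (Φ x * Φ (x + s))) (g := fun x => Φ x ^ 2)
        (I2.sub (I3.const_mul 2)) I1,
      integral_sub (f := fun x => Φ (x + s) ^ 2) (g := fun x => 2 * (Φ x * Φ (x + s))) I2 (I3.const_mul 2),
      integral_const_mul]
  rw [e, hshift]
  ring

/-- Jensen on `[0,1]`: `(∫₀¹ h)² ≤ ∫₀¹ h²` for continuous `h`. [folklore] -/
theorem sq_intervalIntegral_le {h : ℝ → ℝ} (hh : Continuous h) :
    (∫ t in (0:ℝ)..1, h t) ^ 2 ≤ ∫ t in (0:ℝ)..1, h t ^ 2 := by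
  set m : ℝ := ∫ t in (0:ℝ)..1, h t with hm
  have h0 : 0 ≤ ∫ t in (0:ℝ)..1, (h t - m) ^ 2 :=
    intervalIntegral.integral_nonneg zero_le_one fun t _ => sq_nonneg _
  have e : ∫ t in (0:ℝ)..1, (h t - m) ^ 2 = (∫ t in (0:ℝ)..1, h t ^ 2) - 2 * m * (∫ t in (0:ℝ)..1, h t) + m ^ 2 := by
    have : ∀ t, (h t - m) ^ 2 = (h t ^ 2 - 2 * m * h t) + m ^ 2 := fun t => by ring
    simp_rw [this]
    have i1 : IntervalIntegrable (fun t => h t ^ 2) volume 0 1 := (hh.pow 2).intervalIntegrable 0 1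
    have i2 : IntervalIntegrable (fun t => 2 * m * h t) volume 0 1 := (continuous_const.mul hh).intervalIntegrable 0 1
    have i3 : IntervalIntegrable (fun _ => m ^ 2) volume 0 1 := continuous_const.intervalIntegrable 0 1
    rw [intervalIntegral.integral_add (f := fun t => h t ^ 2 - 2 * m * h t) (g := fun _ => m ^ 2) (i1.sub i2) i3,
      intervalIntegral.integral_sub (f := fun t => h t ^ 2) (g := fun t => 2 * m * h t) i1 i2,
      intervalIntegral.integral_const_mul, intervalIntegral.integral_const]
    simp
  rw [e, ← hm] at h0
  nlinarith [h0]

variable (Φ) in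
/-- The directional derivative along `s` at `x + t•s`, as a function of `t`. [folklore] -/
def lineDeriv' (x s : (EuclideanSpace ℝ ι)) (t : ℝ) : ℝ := fderiv ℝ Φ (x + t • s) s

/-- Continuity of `t ↦ DΦ(x + ts)·s` for `C¹` `Φ`. [folklore] -/
theorem continuous_lineDeriv' (hΦ : ContDiff ℝ 1 Φ) (x s : (EuclideanSpace ℝ ι)) : Continuous (lineDeriv' Φ x s) := by
  unfold lineDeriv'
  have hc : Continuous (fderiv ℝ Φ) := hΦ.continuous_fderiv one_ne_zero
  exact (hc.comp (continuous_const.add (continuous_id.smul continuous_const))).clm_apply continuous_const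

/-- **FTC along the segment**: `Φ(x+s) − Φ(x) = ∫₀¹ DΦ(x+ts)·s dt`. [folklore] -/
theorem sub_eq_intervalIntegral_lineDeriv' (hΦ : ContDiff ℝ 1 Φ) (x s : (EuclideanSpace ℝ ι)) :
    Φ (x + s) - Φ x = ∫ t in (0:ℝ)..1, lineDeriv' Φ x s t := by
  have hd : Differentiable ℝ Φ := hΦ.differentiable one_ne_zero
  have hderiv : ∀ t : ℝ, HasDerivAt (fun t : ℝ => Φ (x + t • s)) (lineDeriv' Φ x s t) t := by
    intro t
    have hγ : HasDerivAt (fun t : ℝ => x + t • s) s t := by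
      simpa using ((hasDerivAt_id t).smul_const s).const_add x
    exact (hd (x + t • s)).hasFDerivAt.comp_hasDerivAt t hγ
  rw [intervalIntegral.integral_eq_sub_of_hasDerivAt (fun t _ => hderiv t)
    ((continuous_lineDeriv' hΦ x s).intervalIntegrable _ _)]
  simp

/-- Pointwise: `(Φ(x+s) − Φ(x))² ≤ ∫₀¹ (DΦ(x+ts)·s)² dt`. [folklore] -/
theorem sq_sub_le_intervalIntegral (hΦ : ContDiff ℝ 1 Φ) (x s : (EuclideanSpace ℝ ι)) :
    (Φ (x + s) - Φ x) ^ 2 ≤ ∫ t in (0:ℝ)..1, lineDeriv' Φ x s t ^ 2 := by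
  rw [sub_eq_intervalIntegral_lineDeriv' hΦ x s]
  exact sq_intervalIntegral_le (continuous_lineDeriv' hΦ x s)

/-- The derivative of a compactly supported `C¹` function is continuous and compactly supported in the point, for a fixed
direction: `x ↦ DΦ(x)·s`. [folklore] -/
theorem continuous_fderiv_apply (hΦ : ContDiff ℝ 1 Φ) (s : (EuclideanSpace ℝ ι)) : Continuous fun x => fderiv ℝ Φ x s :=
  (hΦ.continuous_fderiv one_ne_zero).clm_apply continuous_const

omit [Fintype ι] in
/-- `x ↦ DΦ(x)·s` has compact support. [folklore] -/
theorem hasCompactSupport_fderiv_apply (hs : HasCompactSupport Φ) (s : (EuclideanSpace ℝ ι)) :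
    HasCompactSupport fun x => fderiv ℝ Φ x s :=
  hs.fderiv_apply (𝕜 := ℝ) s

/-- **Segment bound**: `∫ (Φ(x+s) − Φ(x))² dx ≤ ∫ (DΦ(x)·s)² dx` (Jensen along the segment, Tonelli, translation
invariance of Lebesgue measure). [folklore] -/
theorem integral_sq_sub_le (hΦ : ContDiff ℝ 1 Φ) (hs : HasCompactSupport Φ) (s : (EuclideanSpace ℝ ι)) :
    ∫ x, (Φ (x + s) - Φ x) ^ 2 ≤ ∫ x, (fderiv ℝ Φ x s) ^ 2 := by
  have hc : Continuous Φ := hΦ.continuous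
  have hΦs : Continuous fun x => Φ (x + s) := hc.comp (continuous_id.add continuous_const)
  -- both sides as lower integrals of nonnegative continuous compactly supported functions
  have hL : 0 ≤ᵐ[volume] fun x => (Φ (x + s) - Φ x) ^ 2 := ae_of_all _ fun x => sq_nonneg _
  have hR : 0 ≤ᵐ[volume] fun x => (fderiv ℝ Φ x s) ^ 2 := ae_of_all _ fun x => sq_nonneg _
  have hRi : Integrable fun x => (fderiv ℝ Φ x s) ^ 2 :=
    ((continuous_fderiv_apply hΦ s).pow 2).integrable_of_hasCompactSupport
      (hasCompactSupport_sq (hasCompactSupport_fderiv_apply hs s))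
  rw [integral_eq_lintegral_of_nonneg_ae hL ((hΦs.sub hc).pow 2).aestronglyMeasurable,
    integral_eq_lintegral_of_nonneg_ae hR ((continuous_fderiv_apply hΦ s).pow 2).aestronglyMeasurable]
  have hfin : ∫⁻ x, ENNReal.ofReal ((fderiv ℝ Φ x s) ^ 2) < ∞ := hRi.lintegral_lt_top
  refine ENNReal.toReal_mono hfin.ne ?_
  -- pointwise Jensen, then Tonelli and translation invariance
  have step1 : ∀ x, ENNReal.ofReal ((Φ (x + s) - Φ x) ^ 2) ≤
      ∫⁻ t in Set.Ioc (0:ℝ) 1, ENNReal.ofReal (lineDeriv' Φ x s t ^ 2) := by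
    intro x
    have hint : IntegrableOn (fun t => lineDeriv' Φ x s t ^ 2) (Set.Ioc 0 1) :=
      ((continuous_lineDeriv' hΦ x s).pow 2).integrableOn_Icc.mono_set Set.Ioc_subset_Icc_self
    rw [← ofReal_integral_eq_lintegral_ofReal hint (ae_of_all _ fun t => sq_nonneg _),
      ← intervalIntegral.integral_of_le zero_le_one]
    exact ENNReal.ofReal_le_ofReal (sq_sub_le_intervalIntegral hΦ x s)
  calc ∫⁻ x, ENNReal.ofReal ((Φ (x + s) - Φ x) ^ 2)
      ≤ ∫⁻ x, ∫⁻ t in Set.Ioc (0:ℝ) 1, ENNReal.ofReal (lineDeriv' Φ x s t ^ 2) := lintegral_mono step1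
    _ = ∫⁻ t in Set.Ioc (0:ℝ) 1, ∫⁻ x, ENNReal.ofReal (lineDeriv' Φ x s t ^ 2) := by
        refine lintegral_lintegral_swap ?_
        refine (ENNReal.measurable_ofReal.comp ?_).aemeasurable
        have hcont : Continuous fun p : (EuclideanSpace ℝ ι) × ℝ => lineDeriv' Φ p.1 s p.2 ^ 2 := by
          unfold lineDeriv'
          refine (((hΦ.continuous_fderiv one_ne_zero).comp ?_).clm_apply continuous_const).pow 2
          exact continuous_fst.add (continuous_snd.smul continuous_const)
        exact hcont.measurable
    _ = ∫⁻ t in Set.Ioc (0:ℝ) 1, ∫⁻ x, ENNReal.ofReal ((fderiv ℝ Φ x s) ^ 2) := by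
        refine lintegral_congr fun t => ?_
        exact lintegral_add_right_eq_self (fun x : (EuclideanSpace ℝ ι) => ENNReal.ofReal ((fderiv ℝ Φ x s) ^ 2)) (t • s)
    _ = ∫⁻ x, ENNReal.ofReal ((fderiv ℝ Φ x s) ^ 2) := by
        rw [lintegral_const, Measure.restrict_apply_univ, Real.volume_Ioc]
        simp

/-! ### §3. The Gaussian form bound -/

/-- The Gaussian weight `e^{-B‖s‖²}` is integrable (`B > 0`). [folklore] -/
theorem integrable_gauss {B : ℝ} (hB : 0 < B) : Integrable fun s : (EuclideanSpace ℝ ι) => Real.exp (-B * ‖s‖ ^ 2) := by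
  refine Integrable.of_integral_ne_zero ?_
  rw [integral_exp_neg_mul_sq_norm hB]
  positivity

/-- `t e^{-a t} ≤ (e a)⁻¹` for `a > 0`, `t` real. [folklore] -/
theorem mul_exp_neg_le {a t : ℝ} (ha : 0 < a) : t * Real.exp (-a * t) ≤ (Real.exp 1 * a)⁻¹ := by
  have h1 : a * t ≤ Real.exp (a * t - 1) := by linarith [Real.add_one_le_exp (a * t - 1)]
  have h2 : Real.exp (a * t - 1) = Real.exp (a * t) * (Real.exp 1)⁻¹ := by rw [Real.exp_sub]; ring
  rw [h2] at h1
  have hexp : 0 < Real.exp (a * t) := Real.exp_pos _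
  have : t * Real.exp (-a * t) = (a * t) / (a * Real.exp (a * t)) := by
    rw [show -a * t = -(a * t) by ring, Real.exp_neg]
    field_simp
  rw [this, div_le_iff₀ (by positivity)]
  calc a * t ≤ Real.exp (a * t) * (Real.exp 1)⁻¹ := h1
    _ = (Real.exp 1 * a)⁻¹ * (a * Real.exp (a * t)) := by field_simp

/-- `‖s‖² e^{-B‖s‖²}` is integrable (`B > 0`). [folklore] -/
theorem integrable_normSq_mul_gauss {B : ℝ} (hB : 0 < B) :
    Integrable fun s : (EuclideanSpace ℝ ι) => ‖s‖ ^ 2 * Real.exp (-B * ‖s‖ ^ 2) := by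
  have hB2 : 0 < B / 2 := by linarith
  refine Integrable.mono' ((integrable_gauss (ι := ι) hB2).const_mul ((Real.exp 1 * (B / 2))⁻¹))
    (by fun_prop) (ae_of_all _ fun s => ?_)
  rw [Real.norm_of_nonneg (by positivity)]
  have h := mul_exp_neg_le (t := ‖s‖ ^ 2) hB2
  have e : Real.exp (-B * ‖s‖ ^ 2) = Real.exp (-(B / 2) * ‖s‖ ^ 2) * Real.exp (-(B / 2) * ‖s‖ ^ 2) := by
    rw [← Real.exp_add]; ring_nf
  rw [e, ← mul_assoc]
  exact mul_le_mul_of_nonneg_right h (Real.exp_pos _).le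

/-- `⟨g,s⟩² e^{-B‖s‖²}` is integrable in `s`. [folklore] -/
theorem integrable_inner_sq_mul_gauss {B : ℝ} (hB : 0 < B) (g : (EuclideanSpace ℝ ι)) :
    Integrable fun s : (EuclideanSpace ℝ ι) => ⟪g, s⟫ ^ 2 * Real.exp (-B * ‖s‖ ^ 2) := by
  refine Integrable.mono' ((integrable_normSq_mul_gauss (ι := ι) hB).const_mul (‖g‖ ^ 2)) (by fun_prop)
    (ae_of_all _ fun s => ?_)
  rw [Real.norm_of_nonneg (by positivity), ← mul_assoc]
  refine mul_le_mul_of_nonneg_right ?_ (Real.exp_pos _).le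
  have h := abs_real_inner_le_norm g s
  rw [← sq_abs, ← mul_pow]
  exact pow_le_pow_left₀ (abs_nonneg _) h 2

/-- `⟨∇Φ(x), s⟩ = DΦ(x)·s` and `‖∇Φ(x)‖ = ‖DΦ(x)‖`. [folklore] -/
theorem inner_gradient_eq (x s : (EuclideanSpace ℝ ι)) : ⟪gradient Φ x, s⟫ = fderiv ℝ Φ x s := by
  show ⟪(InnerProductSpace.toDual ℝ (EuclideanSpace ℝ ι)).symm (fderiv ℝ Φ x), s⟫ = fderiv ℝ Φ x s
  rw [InnerProductSpace.toDual_symm_apply]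

/-- `‖∇Φ(x)‖ = ‖DΦ(x)‖`. [folklore] -/
theorem norm_gradient_eq (x : (EuclideanSpace ℝ ι)) : ‖gradient Φ x‖ = ‖fderiv ℝ Φ x‖ := by
  show ‖(InnerProductSpace.toDual ℝ (EuclideanSpace ℝ ι)).symm (fderiv ℝ Φ x)‖ = ‖fderiv ℝ Φ x‖
  exact LinearIsometryEquiv.norm_map _ _

/-- **The Gaussian form bound.**  For `Φ ∈ C¹_c(ℝⁿ)` and `B > 0`,
`√(π/B)^n · (∫ Φ² − (4B)⁻¹ ∫ ‖∇Φ‖²) ≤ ∫∫ Φ(x) e^{-B‖x−y‖²} Φ(y) dx dy`. [folklore] -/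
theorem gaussForm_ge {B : ℝ} (hB : 0 < B) (hΦ : ContDiff ℝ 1 Φ) (hs : HasCompactSupport Φ) :
    Real.sqrt (π / B) ^ Fintype.card ι * ((∫ x, Φ x ^ 2) - (1 / (4 * B)) * ∫ x, ‖gradient Φ x‖ ^ 2) ≤
      ∫ x, ∫ y, Φ x * Real.exp (-B * ‖x - y‖ ^ 2) * Φ y := by
  set G : (EuclideanSpace ℝ ι) → ℝ := fun s => Real.exp (-B * ‖s‖ ^ 2) with hGdef
  set Z : ℝ := Real.sqrt (π / B) ^ Fintype.card ι with hZ
  have hc : Continuous Φ := hΦ.continuous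
  obtain ⟨C, hC0, hC⟩ := exists_bound_of_hasCompactSupport hc hs
  have hΦi : Integrable Φ := hc.integrable_of_hasCompactSupport hs
  have hGi : Integrable G := integrable_gauss hB
  have hGc : Continuous G := by rw [hGdef]; fun_prop
  have hGsymm : ∀ s, G (-s) = G s := fun s => by simp [hGdef, norm_neg]
  -- Step 1: substitute `y = s + x` in the inner integral and swap
  have step1 : (∫ x, ∫ y, Φ x * Real.exp (-B * ‖x - y‖ ^ 2) * Φ y) = ∫ x, ∫ s, G s * (Φ x * Φ (x + s)) := by
    refine integral_congr_ae (ae_of_all _ fun x => ?_)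
    have h := integral_add_right_eq_self (μ := (volume : Measure (EuclideanSpace ℝ ι)))
      (fun y => Φ x * Real.exp (-B * ‖x - y‖ ^ 2) * Φ y) x
    show (∫ y, Φ x * Real.exp (-B * ‖x - y‖ ^ 2) * Φ y) = ∫ s, G s * (Φ x * Φ (x + s))
    rw [← h]
    refine integral_congr_ae (ae_of_all _ fun s => ?_)
    have : x - (s + x) = -s := by abel
    show Φ x * Real.exp (-B * ‖x - (s + x)‖ ^ 2) * Φ (s + x) = G s * (Φ x * Φ (x + s))
    rw [this, add_comm s x, norm_neg]
    ring
  have hprod : Integrable (fun p : (EuclideanSpace ℝ ι) × (EuclideanSpace ℝ ι) => G p.2 * (Φ p.1 * Φ (p.1 + p.2))) (volume.prod volume) := by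
    have hdom : Integrable (fun p : (EuclideanSpace ℝ ι) × (EuclideanSpace ℝ ι) => (C * |Φ p.1|) * G p.2) (volume.prod volume) :=
      ((hΦi.abs.const_mul C)).mul_prod hGi
    refine hdom.mono' ?_ (ae_of_all _ fun p => ?_)
    · exact ((hGc.comp continuous_snd).mul ((hc.comp continuous_fst).mul
        (hc.comp (continuous_fst.add continuous_snd)))).aestronglyMeasurable
    · rw [Real.norm_eq_abs, abs_mul, abs_mul, abs_of_nonneg (Real.exp_pos _).le]
      have h1 : |Φ (p.1 + p.2)| ≤ C := hC _
      have h2 : 0 ≤ |Φ p.1| := abs_nonneg _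
      have h3 : 0 ≤ G p.2 := (Real.exp_pos _).le
      nlinarith [mul_nonneg h2 h3]
  have step2 : (∫ x, ∫ s, G s * (Φ x * Φ (x + s))) = ∫ s, ∫ x, G s * (Φ x * Φ (x + s)) :=
    integral_integral_swap hprod
  -- Step 2: the inner `x`-integral is `G s · A(s)`, `A(s) = ‖Φ‖² − ½ D(s) ≥ ‖Φ‖² − ½ Q(s)`
  have step3 : ∀ s, (∫ x, G s * (Φ x * Φ (x + s))) =
      G s * ((∫ x, Φ x ^ 2) - (1 / 2 : ℝ) * ∫ x, (Φ (x + s) - Φ x) ^ 2) := by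
    intro s
    rw [integral_const_mul, integral_mul_shift_eq hc hs s]
  have hQ : ∀ s, G s * ((∫ x, Φ x ^ 2) - (1 / 2 : ℝ) * ∫ x, (fderiv ℝ Φ x s) ^ 2) ≤
      G s * ((∫ x, Φ x ^ 2) - (1 / 2 : ℝ) * ∫ x, (Φ (x + s) - Φ x) ^ 2) := by
    intro s
    refine mul_le_mul_of_nonneg_left ?_ (Real.exp_pos _).le
    have := integral_sq_sub_le hΦ hs s
    linarith
  -- Step 3: the derivative term as a double integral
  have hDc : Continuous (fderiv ℝ Φ) := hΦ.continuous_fderiv one_ne_zero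
  have hgrad_int : Integrable fun x => ‖fderiv ℝ Φ x‖ ^ 2 :=
    ((hDc.norm).pow 2).integrable_of_hasCompactSupport (hasCompactSupport_sq (hs.fderiv (𝕜 := ℝ)).norm)
  have hprod2 : Integrable (fun p : (EuclideanSpace ℝ ι) × (EuclideanSpace ℝ ι) => G p.1 * (fderiv ℝ Φ p.2 p.1) ^ 2) (volume.prod volume) := by
    have hdom : Integrable (fun p : (EuclideanSpace ℝ ι) × (EuclideanSpace ℝ ι) => (‖p.1‖ ^ 2 * G p.1) * ‖fderiv ℝ Φ p.2‖ ^ 2) (volume.prod volume) :=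
      (integrable_normSq_mul_gauss hB).mul_prod hgrad_int
    refine hdom.mono' ?_ (ae_of_all _ fun p => ?_)
    · exact ((hGc.comp continuous_fst).mul (((hDc.comp continuous_snd).clm_apply continuous_fst).pow 2)).aestronglyMeasurable
    · rw [Real.norm_of_nonneg (by positivity)]
      have h1 : |fderiv ℝ Φ p.2 p.1| ≤ ‖fderiv ℝ Φ p.2‖ * ‖p.1‖ := by
        rw [← Real.norm_eq_abs]; exact (fderiv ℝ Φ p.2).le_opNorm p.1
      have h2 : (fderiv ℝ Φ p.2 p.1) ^ 2 ≤ (‖fderiv ℝ Φ p.2‖ * ‖p.1‖) ^ 2 := by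
        rw [← sq_abs]; exact pow_le_pow_left₀ (abs_nonneg _) h1 2
      have h3 : 0 ≤ G p.1 := (Real.exp_pos _).le
      calc G p.1 * (fderiv ℝ Φ p.2 p.1) ^ 2 ≤ G p.1 * (‖fderiv ℝ Φ p.2‖ * ‖p.1‖) ^ 2 :=
            mul_le_mul_of_nonneg_left h2 h3
        _ = ‖p.1‖ ^ 2 * G p.1 * ‖fderiv ℝ Φ p.2‖ ^ 2 := by ring
  have hQi : Integrable (fun s => ∫ x, G s * (fderiv ℝ Φ x s) ^ 2) := hprod2.integral_prod_left
  have hQval : (∫ s, ∫ x, G s * (fderiv ℝ Φ x s) ^ 2) = Z / (2 * B) * ∫ x, ‖gradient Φ x‖ ^ 2 := by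
    rw [integral_integral_swap hprod2]
    have e : ∀ x : (EuclideanSpace ℝ ι), (∫ s, G s * (fderiv ℝ Φ x s) ^ 2) = Z / (2 * B) * ‖gradient Φ x‖ ^ 2 := by
      intro x
      have h := integral_inner_sq_mul_exp_neg_mul_sq_norm hB (gradient Φ x)
      simp only [inner_gradient_eq] at h
      rw [show (fun s => G s * (fderiv ℝ Φ x s) ^ 2) = fun s => (fderiv ℝ Φ x s) ^ 2 * Real.exp (-B * ‖s‖ ^ 2) from
        funext fun s => by rw [hGdef]; ring, h, hZ]
      ring
    simp_rw [e]
    rw [integral_const_mul]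
  -- Step 4: assemble
  have hAi : Integrable (fun s => ∫ x, G s * (Φ x * Φ (x + s))) := by
    have h := hprod.swap.integral_prod_left
    simpa [Function.comp] using h
  have hmain : (∫ s, G s * ((∫ x, Φ x ^ 2) - (1 / 2 : ℝ) * ∫ x, (fderiv ℝ Φ x s) ^ 2)) ≤
      ∫ s, ∫ x, G s * (Φ x * Φ (x + s)) := by
    refine integral_mono ?_ hAi fun s => ?_
    · have e : (fun s => G s * ((∫ x, Φ x ^ 2) - (1 / 2 : ℝ) * ∫ x, (fderiv ℝ Φ x s) ^ 2)) =
          fun s => (∫ x, Φ x ^ 2) * G s - (1 / 2 : ℝ) * ∫ x, G s * (fderiv ℝ Φ x s) ^ 2 := by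
        funext s; rw [integral_const_mul]; ring
      rw [e]
      exact (hGi.const_mul _).sub (hQi.const_mul _)
    · show G s * ((∫ x, Φ x ^ 2) - (1 / 2 : ℝ) * ∫ x, (fderiv ℝ Φ x s) ^ 2) ≤ ∫ x, G s * (Φ x * Φ (x + s))
      rw [step3 s]
      exact hQ s
  have hval : (∫ s, G s * ((∫ x, Φ x ^ 2) - (1 / 2 : ℝ) * ∫ x, (fderiv ℝ Φ x s) ^ 2)) =
      Z * ((∫ x, Φ x ^ 2) - (1 / (4 * B)) * ∫ x, ‖gradient Φ x‖ ^ 2) := by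
    have e : (fun s => G s * ((∫ x, Φ x ^ 2) - (1 / 2 : ℝ) * ∫ x, (fderiv ℝ Φ x s) ^ 2)) =
        fun s => (∫ x, Φ x ^ 2) * G s - (1 / 2 : ℝ) * ∫ x, G s * (fderiv ℝ Φ x s) ^ 2 := by
      funext s; rw [integral_const_mul]; ring
    rw [e, integral_sub (hGi.const_mul _) (hQi.const_mul _), integral_const_mul, integral_const_mul, hQval]
    rw [show (∫ a, G a) = Z from integral_exp_neg_mul_sq_norm hB]
    have hB0 : B ≠ 0 := hB.ne'
    field_simp
    ring
  rw [step1, step2, ← hval]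
  exact hmain

end Summit.QuantumFields.YangMills.Theorems.FemtoTransferGap.GaussForm

end
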